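/-
Copyright (c) 2026 the pub-hodgecm-mathlib formalisation cell (harness21).  Prover seat hodgecm-mathlib-B-p14 (g32) — (R2) glue ∕ assembly heir, 2026-09-01.
«EP-RAM-FOLD»: the letter (R2) from the tame non-elliptic relation and the wild ramified residue.
-/
import Literature.NumberTheory.Rogawski1990.RankOneEulerPoincareNonsplitOfRamified             -- ★ (B-p14 g32) p843527: `rankOneEulerPoincareNonsplit_of_ramified`
import Literature.NumberTheory.Rogawski1990.RankOneEulerPoincareNonsplitRamifiedOfNonElliptic  -- ★ (B-p14 g32) p843526: the tame package modulo (N) at `(K♯_η, K, K♯_η ⊓ K)`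
import Literature.NumberTheory.Automorphic.RamifiedPlaceAntiFixedUniformizer                 -- ★ p843426: an anti-fixed uniformiser `σ_w η = −η` at a tamely ramified place
import Literature.NumberTheory.Automorphic.ValuedFieldValuativeRelBridge                       -- ★ `v_eq_one_iff_valuation_eq_one` (the `Valued` ∕ `ValuativeRel` bridge)
import HarnessLib

/-!
# The rank-one Euler–Poincaré letter (R2) from the tame non-elliptic relation and the wild ramified residue

Topic `NumberTheory/Rogawski1990`, namespace `Literature.NumberTheory.Rogawski1990`.  THEOREMS ONLY: no definition, no named fact, no instance, no notation,
no `sorry`; kernel lane.  The next fold of the (R2) road for `stub_N6nsR2EP : RankOneEulerPoincareNonsplit` (crux H413, line «N6nsGerm»).  After ★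
`rankOneEulerPoincareNonsplit_of_ramified` (the unramified places, B-p04 (g35) ★ p843494) and ★ `exists_isLocSmooth_classOrbitalIntegral_eq_one_zero_of_ramified_of_nonEllipticRelation`
(the tame-ramified package modulo (N), over ★ B-p04 p843501 ∕ ★ A-p06 (g27) ramified transitivity ∕ ★ A-p17 (T3)(T4)), the letter rests on exactly TWO inputs, both stated
here as hypotheses with the place `w ∣ v` (`w̄ = w`, `e(w|v) ≠ 1`) in hand:
* `hNtame` — Kottwitz's NON-ELLIPTIC relation at a TAMELY ramified place (`2 ∈ 𝒪_w^×`) at the levels `(K♯_η, K, K♯_η ⊓ K)` of ★ «EP-RAM-PKG» for an ANTI-FIXED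
  uniformiser `η` (`|η| = exp(−1)`, `σ_w η = −η`, ★ `exists_uniformizer_galAdicCompletionMap_complexConj_eq_neg_of_ramified`): «per period of the split torus, fixed
  vertices = fixed edges» — A-p06 (g27) ★ (S7b) p843537 `natCard_quotient_fixed_add_eq_natCard_quotient_fixedFlags'` assembled on `U₂` = (S8) (EP pen heir B-p04 (g35));
* `hwild` — the letter's own body at the WILDLY ramified non-split places (`2 ∉ 𝒪_w^×`): a booked residue (dyadic hermitian lattices [Jacobowitz1962 §§9–11]; no in-house road).
`e(w|v) ≠ 1` is read off `¬ IsUnramifiedIn` at the unique place above `v` (§1, Mathlib `Ideal.ramificationIdx_eq_one_iff`; cf. ★ `isUnramifiedIn_of_ramificationIdx'_eq_one`).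
HONEST LABEL: HC_CM is proved only modulo the cell's remaining named inputs (hLiu418, h413) until rung 0 closes; this file is unconditional (its two inputs
are hypotheses, not `sorry`s), and (R2) itself is a PRINTED theorem [Kottwitz1988, §2 Thm. 2].

## References
* [Kottwitz1988] R. E. Kottwitz, *Tamagawa numbers*, Ann. of Math. 127 (1988), 629–646, §2 Theorem 2.
* [Rogawski1990] J. D. Rogawski, *Automorphic Representations of Unitary Groups in Three Variables* (1990), §12.6 p. 174.
* [Serre1980Trees] J.-P. Serre, *Trees* (1980), Ch. II §1.1.
* [NeukirchANT1999] J. Neukirch, *Algebraic Number Theory* (1999), Ch. I §8 Prop. (8.2) (`e(w|v)` at the unique prime above `v`).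
-/

set_option autoImplicit false

noncomputable section

open scoped ValuativeRel Matrix MatrixGroups
open Matrix ValuativeRel NumberField IsDedekindDomain MulAction MeasureTheory Measure

namespace Literature.NumberTheory.Rogawski1990

open Literature.NumberTheory.Automorphic Literature.NumberTheory.Automorphic.UnitaryGroup Literature.NumberTheory.GaloisRepresentations

/-! ## §1 `e(w|v) ≠ 1` at the place above a ramified non-split `v` -/

/-- **At a non-split `v` ramified in `L`, `e(w|v) ≠ 1` for the place `w ∣ v`** (`w` is the only prime above `v`, ★ `PlacesOver.eq_of_smul_eq`; Mathlib
`Algebra.IsUnramifiedIn` = every prime above is unramified, `Ideal.ramificationIdx_eq_one_iff`).  Contrapositive twin of ★ `isUnramifiedIn_of_ramificationIdx'_eq_one`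
(Liu-D1 chain) and of ★ `ramificationIdx'_ne_one_of_not_isUnramifiedIn` (R1LL chain, p843548), re-proved privately here to keep the (R2) import closure
small. [cite: NeukirchANT1999, Ch. I §8 Prop. (8.2)] -/
private theorem ramificationIdx'_ne_one_of_not_isUnramifiedIn_of_smul_eq (L : Type) [Field L] [NumberField L] [IsCMField L]
    {v : HeightOneSpectrum (𝓞 ↥(maximalRealSubfield L))} (w : UnitaryGroup.PlacesOver L v) (hw : IsCMField.complexConj L • w.1 = w.1)
    (hram : ¬ Algebra.IsUnramifiedIn (𝓞 L) v.asIdeal) : v.asIdeal.ramificationIdx' w.1.asIdeal ≠ 1 := by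
  haveI : Algebra.IsQuadraticExtension ↥(maximalRealSubfield L) L := IsCMField.isQuadraticExtension L
  intro he
  apply hram
  intro P hP hPover
  have hP0 : P ≠ ⊥ := Ideal.ne_bot_of_liesOver_of_ne_bot v.ne_bot P
  have hPw : P = w.1.asIdeal :=
    congrArg (fun u : UnitaryGroup.PlacesOver L v => u.1.asIdeal)
      (UnitaryGroup.PlacesOver.eq_of_smul_eq (IsCMField.complexConj L) (IsCMField.complexConj_ne_one L) w hw
        ⟨⟨P, hP, hP0⟩, HeightOneSpectrum.ext hPover.over.symm⟩)
  subst hPw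
  haveI : v.asIdeal.IsMaximal := v.isMaximal
  rw [← Ideal.ramificationIdx_eq_one_iff, ← Ideal.ramificationIdx'_eq_ramificationIdx v.asIdeal w.1.asIdeal v.ne_bot]
  exact he

/-! ## §2 The letter from the tame non-elliptic relation and the wild residue -/

/-- **(R2) FROM THE TAME NON-ELLIPTIC RELATION AND THE WILD RAMIFIED RESIDUE.**  `hNtame`: at every tamely ramified non-split `(L, v, w)` and every anti-fixed
uniformiser `η` of `L_w`, the non-elliptic relation (N) at `(K♯_η, K, K♯_η ⊓ K)` for every Haar `ν` and canonical `m` ((S8), A-p06 (g27) ∕ B-p04 (g35)); `hwild`: the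
body of the letter at the wildly ramified non-split places.  Then `RankOneEulerPoincareNonsplit` — ★ `rankOneEulerPoincareNonsplit_of_ramified` with the tame places
discharged by ★ `exists_isLocSmooth_classOrbitalIntegral_eq_one_zero_of_ramified_of_nonEllipticRelation` at the anti-fixed `η` of ★
`exists_uniformizer_galAdicCompletionMap_complexConj_eq_neg_of_ramified`. [cite: Kottwitz1988, §2 Theorem 2] [cite: Rogawski1990, §12.6 p. 174] [cite: Serre1980Trees, II.1.1] -/
theorem rankOneEulerPoincareNonsplit_of_tameNonElliptic_of_wildRamified
    (hNtame : ∀ (L : Type) [Field L] [NumberField L] [IsCMField L] (v : HeightOneSpectrum (𝓞 ↥(maximalRealSubfield L)))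
      (w : UnitaryGroup.PlacesOver L v) (hw : IsCMField.complexConj L • w.1 = w.1),
      v.asIdeal.ramificationIdx' w.1.asIdeal ≠ 1 → IsUnit (2 : 𝒪[(w.1.adicCompletion L)]) →
      ∀ (η : (w.1.adicCompletion L)ˣ), Valued.v (η : w.1.adicCompletion L) = WithZero.exp (-1 : ℤ) →
      galAdicCompletionMap (L := L) (IsCMField.complexConj L) hw (η : w.1.adicCompletion L) = -η →
      ∀ [MeasurableSpace ((UnitaryGroup.cmDatum L 2 (Matrix.of fun i j : Fin 2 => if i.val + j.val + 1 = 2 then (1 : L) else 0)).Local v)]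
        [BorelSpace ((UnitaryGroup.cmDatum L 2 (Matrix.of fun i j : Fin 2 => if i.val + j.val + 1 = 2 then (1 : L) else 0)).Local v)]
        (ν : Measure ((UnitaryGroup.cmDatum L 2 (Matrix.of fun i j : Fin 2 => if i.val + j.val + 1 = 2 then (1 : L) else 0)).Local v))
        [ν.IsHaarMeasure] [ν.IsMulRightInvariant]
        [_iZ : ∀ γ : (UnitaryGroup.cmDatum L 2 (Matrix.of fun i j : Fin 2 => if i.val + j.val + 1 = 2 then (1 : L) else 0)).Local v,
          MeasurableSpace (((UnitaryGroup.cmDatum L 2 (Matrix.of fun i j : Fin 2 => if i.val + j.val + 1 = 2 then (1 : L) else 0)).Local v) ⧸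
            Subgroup.centralizer ({γ} : Set ((UnitaryGroup.cmDatum L 2 (Matrix.of fun i j : Fin 2 => if i.val + j.val + 1 = 2 then (1 : L) else 0)).Local v)))]
        [_bZ : ∀ γ : (UnitaryGroup.cmDatum L 2 (Matrix.of fun i j : Fin 2 => if i.val + j.val + 1 = 2 then (1 : L) else 0)).Local v,
          BorelSpace (((UnitaryGroup.cmDatum L 2 (Matrix.of fun i j : Fin 2 => if i.val + j.val + 1 = 2 then (1 : L) else 0)).Local v) ⧸
            Subgroup.centralizer ({γ} : Set ((UnitaryGroup.cmDatum L 2 (Matrix.of fun i j : Fin 2 => if i.val + j.val + 1 = 2 then (1 : L) else 0)).Local v)))]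
        (m : OrbitalMeasureFamily ((UnitaryGroup.cmDatum L 2 (Matrix.of fun i j : Fin 2 => if i.val + j.val + 1 = 2 then (1 : L) else 0)).Local v)),
        m.IsCanonical (fun γ => IsRegularElt (γ.val : GL (Fin 2) (UnitaryGroup.LocalRing L v))) ν →
        ∀ γ : (cmDatum L 2 (Matrix.of fun i j : Fin 2 => if i.val + j.val + 1 = 2 then (1 : L) else 0)).Local v,
      IsRegularElt (γ.val : GL (Fin 2) (UnitaryGroup.LocalRing L v)) →
      ¬ CompactSpace (Subgroup.centralizer ({γ} : Set ((cmDatum L 2 (Matrix.of fun i j : Fin 2 => if i.val + j.val + 1 = 2 then (1 : L) else 0)).Local v))) →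
      (((ν ((((glInt 2 (w.1.adicCompletion L)).map (MulAut.conj (glDiagonal 2 (w.1.adicCompletion L) ![1, η])).toMonoidHom).comap
          (((unitaryGroupOfForm (galAdicCompletionMap (L := L) (IsCMField.complexConj L) hw)
            (placeForm (Matrix.of fun i j : Fin 2 => if i.val + j.val + 1 = 2 then (1 : L) else 0) w.1)).subtype.comp
            (localNonsplitEquiv (IsCMField.complexConj L) (Matrix.of fun i j : Fin 2 => if i.val + j.val + 1 = 2 then (1 : L) else 0)
          (IsCMField.complexConj_ne_one L) w hw).toMonoidHom :
            (cmDatum L 2 (Matrix.of fun i j : Fin 2 => if i.val + j.val + 1 = 2 then (1 : L) else 0)).Local v →* GL (Fin 2) (w.1.adicCompletion L)))))).toReal : ℂ))⁻¹ *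
          classOrbitalIntegral m
            ((((((glInt 2 (w.1.adicCompletion L)).map (MulAut.conj (glDiagonal 2 (w.1.adicCompletion L) ![1, η])).toMonoidHom).comap
          (((unitaryGroupOfForm (galAdicCompletionMap (L := L) (IsCMField.complexConj L) hw)
            (placeForm (Matrix.of fun i j : Fin 2 => if i.val + j.val + 1 = 2 then (1 : L) else 0) w.1)).subtype.comp
            (localNonsplitEquiv (IsCMField.complexConj L) (Matrix.of fun i j : Fin 2 => if i.val + j.val + 1 = 2 then (1 : L) else 0)
          (IsCMField.complexConj_ne_one L) w hw).toMonoidHom :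
            (cmDatum L 2 (Matrix.of fun i j : Fin 2 => if i.val + j.val + 1 = 2 then (1 : L) else 0)).Local v →* GL (Fin 2) (w.1.adicCompletion L)))) : Subgroup ((cmDatum L 2 (Matrix.of fun i j : Fin 2 => if i.val + j.val + 1 = 2 then (1 : L) else 0)).Local v)) : Set ((cmDatum L 2 (Matrix.of fun i j : Fin 2 => if i.val + j.val + 1 = 2 then (1 : L) else 0)).Local v)).indicator fun _ => (1 : ℂ))
            (ConjClasses.mk γ) +
        (((ν (cmLocalIntegralLevel L 2 (Matrix.of fun i j : Fin 2 => if i.val + j.val + 1 = 2 then (1 : L) else 0) v)).toReal : ℂ))⁻¹ *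
          classOrbitalIntegral m
            (((cmLocalIntegralLevel L 2 (Matrix.of fun i j : Fin 2 => if i.val + j.val + 1 = 2 then (1 : L) else 0) v) : Set ((cmDatum L 2 (Matrix.of fun i j : Fin 2 => if i.val + j.val + 1 = 2 then (1 : L) else 0)).Local v)).indicator fun _ => (1 : ℂ))
            (ConjClasses.mk γ) -
        (((ν ((((glInt 2 (w.1.adicCompletion L)).map (MulAut.conj (glDiagonal 2 (w.1.adicCompletion L) ![1, η])).toMonoidHom).comap
          (((unitaryGroupOfForm (galAdicCompletionMap (L := L) (IsCMField.complexConj L) hw)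
            (placeForm (Matrix.of fun i j : Fin 2 => if i.val + j.val + 1 = 2 then (1 : L) else 0) w.1)).subtype.comp
            (localNonsplitEquiv (IsCMField.complexConj L) (Matrix.of fun i j : Fin 2 => if i.val + j.val + 1 = 2 then (1 : L) else 0)
          (IsCMField.complexConj_ne_one L) w hw).toMonoidHom :
            (cmDatum L 2 (Matrix.of fun i j : Fin 2 => if i.val + j.val + 1 = 2 then (1 : L) else 0)).Local v →* GL (Fin 2) (w.1.adicCompletion L)))) ⊓
            cmLocalIntegralLevel L 2 (Matrix.of fun i j : Fin 2 => if i.val + j.val + 1 = 2 then (1 : L) else 0) v)).toReal : ℂ))⁻¹ *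
          classOrbitalIntegral m
            ((((((glInt 2 (w.1.adicCompletion L)).map (MulAut.conj (glDiagonal 2 (w.1.adicCompletion L) ![1, η])).toMonoidHom).comap
          (((unitaryGroupOfForm (galAdicCompletionMap (L := L) (IsCMField.complexConj L) hw)
            (placeForm (Matrix.of fun i j : Fin 2 => if i.val + j.val + 1 = 2 then (1 : L) else 0) w.1)).subtype.comp
            (localNonsplitEquiv (IsCMField.complexConj L) (Matrix.of fun i j : Fin 2 => if i.val + j.val + 1 = 2 then (1 : L) else 0)
          (IsCMField.complexConj_ne_one L) w hw).toMonoidHom :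
            (cmDatum L 2 (Matrix.of fun i j : Fin 2 => if i.val + j.val + 1 = 2 then (1 : L) else 0)).Local v →* GL (Fin 2) (w.1.adicCompletion L)))) ⊓
              cmLocalIntegralLevel L 2 (Matrix.of fun i j : Fin 2 => if i.val + j.val + 1 = 2 then (1 : L) else 0) v : Subgroup ((cmDatum L 2 (Matrix.of fun i j : Fin 2 => if i.val + j.val + 1 = 2 then (1 : L) else 0)).Local v)) : Set ((cmDatum L 2 (Matrix.of fun i j : Fin 2 => if i.val + j.val + 1 = 2 then (1 : L) else 0)).Local v)).indicator fun _ => (1 : ℂ))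
            (ConjClasses.mk γ) = 0)
    (hwild : ∀ (L : Type) [Field L] [NumberField L] [IsCMField L] (v : HeightOneSpectrum (𝓞 ↥(maximalRealSubfield L)))
      (w : UnitaryGroup.PlacesOver L v) (hw : IsCMField.complexConj L • w.1 = w.1),
      v.asIdeal.ramificationIdx' w.1.asIdeal ≠ 1 → ¬ IsUnit (2 : 𝒪[(w.1.adicCompletion L)]) →
      ∀ [MeasurableSpace ((UnitaryGroup.cmDatum L 2 (Matrix.of fun i j : Fin 2 => if i.val + j.val + 1 = 2 then (1 : L) else 0)).Local v)]
        [BorelSpace ((UnitaryGroup.cmDatum L 2 (Matrix.of fun i j : Fin 2 => if i.val + j.val + 1 = 2 then (1 : L) else 0)).Local v)]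
        (ν : Measure ((UnitaryGroup.cmDatum L 2 (Matrix.of fun i j : Fin 2 => if i.val + j.val + 1 = 2 then (1 : L) else 0)).Local v))
        [ν.IsHaarMeasure] [ν.IsMulRightInvariant]
        [_iZ : ∀ γ : (UnitaryGroup.cmDatum L 2 (Matrix.of fun i j : Fin 2 => if i.val + j.val + 1 = 2 then (1 : L) else 0)).Local v,
          MeasurableSpace (((UnitaryGroup.cmDatum L 2 (Matrix.of fun i j : Fin 2 => if i.val + j.val + 1 = 2 then (1 : L) else 0)).Local v) ⧸
            Subgroup.centralizer ({γ} : Set ((UnitaryGroup.cmDatum L 2 (Matrix.of fun i j : Fin 2 => if i.val + j.val + 1 = 2 then (1 : L) else 0)).Local v)))]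
        [_bZ : ∀ γ : (UnitaryGroup.cmDatum L 2 (Matrix.of fun i j : Fin 2 => if i.val + j.val + 1 = 2 then (1 : L) else 0)).Local v,
          BorelSpace (((UnitaryGroup.cmDatum L 2 (Matrix.of fun i j : Fin 2 => if i.val + j.val + 1 = 2 then (1 : L) else 0)).Local v) ⧸
            Subgroup.centralizer ({γ} : Set ((UnitaryGroup.cmDatum L 2 (Matrix.of fun i j : Fin 2 => if i.val + j.val + 1 = 2 then (1 : L) else 0)).Local v)))]
        (m : OrbitalMeasureFamily ((UnitaryGroup.cmDatum L 2 (Matrix.of fun i j : Fin 2 => if i.val + j.val + 1 = 2 then (1 : L) else 0)).Local v)),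
        m.IsCanonical (fun γ => IsRegularElt (γ.val : GL (Fin 2) (UnitaryGroup.LocalRing L v))) ν →
        ∃ f : (UnitaryGroup.cmDatum L 2 (Matrix.of fun i j : Fin 2 => if i.val + j.val + 1 = 2 then (1 : L) else 0)).Local v → ℂ, IsLocSmooth f ∧
          (∀ γ : (UnitaryGroup.cmDatum L 2 (Matrix.of fun i j : Fin 2 => if i.val + j.val + 1 = 2 then (1 : L) else 0)).Local v,
              IsRegularElt (γ.val : GL (Fin 2) (UnitaryGroup.LocalRing L v)) →
              CompactSpace (Subgroup.centralizer ({γ} : Set ((UnitaryGroup.cmDatum L 2 (Matrix.of fun i j : Fin 2 => if i.val + j.val + 1 = 2 then (1 : L) else 0)).Local v))) →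
              classOrbitalIntegral m f (ConjClasses.mk γ) = 1) ∧
          (∀ γ : (UnitaryGroup.cmDatum L 2 (Matrix.of fun i j : Fin 2 => if i.val + j.val + 1 = 2 then (1 : L) else 0)).Local v,
              IsRegularElt (γ.val : GL (Fin 2) (UnitaryGroup.LocalRing L v)) →
              ¬ CompactSpace (Subgroup.centralizer ({γ} : Set ((UnitaryGroup.cmDatum L 2 (Matrix.of fun i j : Fin 2 => if i.val + j.val + 1 = 2 then (1 : L) else 0)).Local v))) →
              classOrbitalIntegral m f (ConjClasses.mk γ) = 0)) :
    RankOneEulerPoincareNonsplit := by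
  refine rankOneEulerPoincareNonsplit_of_ramified (fun L _ _ _ v w hw hram => ?_)
  intro _ _ ν _ _ _ _ m hm
  have he := ramificationIdx'_ne_one_of_not_isUnramifiedIn_of_smul_eq L w hw hram
  by_cases h2 : IsUnit (2 : 𝒪[(w.1.adicCompletion L)])
  · have h2v : Valued.v (2 : w.1.adicCompletion L) = 1 := by
      have h := (Valuation.integer.integers (valuation (w.1.adicCompletion L))).isUnit_iff_valuation_eq_one.1 h2
      rw [map_ofNat, ← v_eq_one_iff_valuation_eq_one] at h
      exact h
    obtain ⟨η, hη, hση⟩ := exists_uniformizer_galAdicCompletionMap_complexConj_eq_neg_of_ramified L w hw he h2v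
    exact exists_isLocSmooth_classOrbitalIntegral_eq_one_zero_of_ramified_of_nonEllipticRelation L w hw he h2 η hη ν hm
      (hNtame L v w hw he h2 η hη hση ν m hm)
  · exact hwild L v w hw he h2 ν m hm

end Literature.NumberTheory.Rogawski1990

end
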